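import Literature.Analysis.Complex.FarFactorReal
import HarnessLib

/-!
# Hadamard's factorisation theorem in genus one (proved)

Trunk T-ANALYSIS support (complex analysis, `Literature/Analysis/Complex`), continuation of
`HadamardGenusZeroProofs.lean` (genus `0`) to genus `1`.

**Hadamard's Factorization Theorem** [Conway 1978, Ch. XI, Thm. 3.4]: an entire function `f` of
finite order `λ` has finite genus `μ ≤ λ`, i.e. [Conway 1978, Ch. XI, Def. 2.5 and (2.3)]
`f(z) = z^m e^{g(z)} ∏ₙ E_μ(z/aₙ)` with `g` a polynomial of degree `≤ μ`, `aₙ` the non-zero zeros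
repeated with multiplicity and `Σ |aₙ|^{-(μ+1)} < ∞`. The case `1 ≤ λ < 2` (so `μ ≤ 1`), with the
primary factor `E₁(u) = (1 − u) e^{u}` and `f(0) ≠ 0` (so `m = 0`), reads: `Σₙ 1/|aₙ|² < ∞` and

  `f(z) = f(0) e^{A z} ∏ₙ (1 − z/aₙ) e^{z/aₙ}`  for all `z ∈ ℂ`, with `A = f'(0)/f(0)`

(the linear polynomial `g(z) = log f(0) + A z` is forced by comparing values and logarithmic
derivatives at `0`, since `E₁'(0) = 0`). This is the factorisation of `ξ(s)`, `ξ(s, χ)` and of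
Booker's `Λ`-functions (Davenport, *Multiplicative Number Theory*, Ch. 12 (2)–(3); Booker 2006,
(4–12)), which are entire of order exactly `1` and so out of reach of the tree's genus-zero theorem
`Literature.Analysis.Complex.hadamard_genus_zero_holds`.

## Main statements (all proved, standard axioms)

* `Literature.Analysis.Complex.HadamardGenusOne.hadamard_core` — for `f` entire with
  `‖f z‖ ≤ C exp (‖z‖^σ)`, `0 ≤ σ < 2`, `C ≥ 1`, `f 0 ≠ 0`: `Σ 1/‖u‖²` over the zeros with
  multiplicity (index type `HadamardGenusZero.ZIdx f`) is summable, and for every `z`,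
  `HasProd (fun i => (1 − z/uᵢ) e^{z/uᵢ}) (f z / (f 0 · e^{(f'(0)/f(0)) z}))`.
* `Literature.Analysis.Complex.hadamard_genus_one_zeros` — **Conway XI Thm. 3.4 in genus one**,
  packaged like the tree's `hadamard_genus_zero_zeros`: for `f` entire, `‖f z‖ ≤ C exp (‖z‖^ρ)`
  with `ρ < 2`, `f 0 ≠ 0`, there is `b : ℕ → ℂ` (the inverses of the zeros repeated with
  multiplicity, padded with zeros) with `Σ ‖bₙ‖² < ∞`, `f (bₙ⁻¹) = 0` for `bₙ ≠ 0`, exactly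
  `analyticOrderNatAt f a` indices with `bₙ = a⁻¹` for each `a ≠ 0`, and
  `HasProd (fun n => (1 − bₙ z) e^{bₙ z}) (f z / (f 0 · exp ((deriv f 0 / f 0) z)))` for every `z`.
* `Literature.Analysis.Complex.hadamard_genus_one` — the same without the description of the `bₙ`.

## Proof

Not Conway's (no estimate of canonical products from below, no Weierstrass theory). For a radius
`R` write `f = P_R · G_R` on `|z| ≤ R` with `P_R(z) = ∏_{|u| ≤ R/2} (z − u)^{m(u)}` and the *far
factor* `G_R` zero-free on `|z| ≤ R/2` (the tree's `exists_eq_prod_pow_sub_mul`, Titchmarsh §3.9).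
Titchmarsh's Lemma α with one Cauchy estimate (the tree's `KimLee.norm_logDeriv_farFactor_le_of_ne_zero`,
`KimLee.norm_deriv_logDeriv_le`) gives `|(G_R'/G_R)'| ≤ 16 ε_R/R` on `|z| ≤ R/16` with
`ε_R ≤ (16/R)(K + 2R^σ)` (Jensen's bound for the number of zeros, `KimLee.titchmarshBound_le`), so
`G_R(z) = G_R(0) e^{β_R z} e^{φ_R(z)}` with `β_R = G_R'/G_R(0) = f'/f(0) + Σ_{|u|≤R/2} m(u)/u` and
`|φ_R(z)| ≤ 256 r (K + 2R^σ) |z| / R² → 0` on a fixed disc `|z| < r` (`σ < 2`). Unwinding,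
`∏_{|u| ≤ R/2} E₁(z/u)^{m(u)} = e^{−A z} f(z)/f(0) · e^{−φ_R(z)} → e^{−A z} f(z)/f(0)`. Jensen's
inequality and a dyadic decomposition give `Σ m(u)/|u|² < ∞`, whence `Σ |E₁(z/u) − 1| < ∞`
(`|E₁(w) − 1| ≤ |w|² e^{|w|}`), and absolute convergence upgrades the limit over discs to Mathlib's
unconditional `HasProd`, exactly as in the genus-zero file.

## References

* J. B. Conway, *Functions of One Complex Variable I*, 2nd ed., GTM 11, Springer 1978, Ch. XI
  §2 (2.3) and Def. 2.5 (genus; held scan `book:conway1978-functions-one-complex-variable-i`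
  p. 297), §3 Thm. 3.4 "If f is an entire function of finite order λ then f has finite genus
  μ ≤ λ" (held scan p. 302). [cite: Conway1978, Ch. XI Thm. 3.4]
* E. C. Titchmarsh, *The Theory of the Riemann Zeta-Function*, 2nd ed., Oxford 1986, §3.9 Lemma α.
* H. Davenport, *Multiplicative Number Theory*, 3rd ed., GTM 74, Ch. 11–12 (the applications).
-/

noncomputable section

open Complex Filter Metric Set Topology MeromorphicOn

namespace Literature.Analysis.Complex

namespace HadamardGenusOne

open Literature.Analysis.Complex.HadamardGenusZero Literature.Analysis.Complex.KimLee

variable {f : ℂ → ℂ}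

/-! ### The primary factor `E₁(w) = (1 − w) e^{w}` -/

/-- `‖(1 − w) e^{w} − 1‖ ≤ ‖w‖² e^{‖w‖}`: the derivative of `E₁` is `−u e^{u}`, of norm
`≤ ‖w‖ e^{‖w‖}` on the disc `‖u‖ ≤ ‖w‖` (mean value inequality). Conway's Lemma VII.5.11 is
`|1 − E_p(z)| ≤ |z|^{p+1}` for `|z| ≤ 1`; this is its `p = 1` case in a form valid for all `z`
(with the harmless factor `e^{|z|}`). [cite: Conway1978, Ch. VII Lemma 5.11 (p = 1, all z; held scan p. 188)] -/
theorem norm_primaryFactor_sub_one_le (w : ℂ) :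
    ‖(1 - w) * exp w - 1‖ ≤ ‖w‖ ^ 2 * Real.exp ‖w‖ := by
  have hd : ∀ u : ℂ, HasDerivAt (fun u : ℂ => (1 - u) * exp u) (-u * exp u) u := by
    intro u
    have h1 : HasDerivAt (fun u : ℂ => 1 - u) (-1) u := by
      simpa using (hasDerivAt_id u).const_sub 1
    have h2 := h1.fun_mul (Complex.hasDerivAt_exp u)
    refine h2.congr_deriv ?_
    ring
  have hbound : ∀ u ∈ closedBall (0 : ℂ) ‖w‖,
      ‖deriv (fun u : ℂ => (1 - u) * exp u) u‖ ≤ ‖w‖ * Real.exp ‖w‖ := by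
    intro u hu
    rw [mem_closedBall_zero_iff] at hu
    rw [(hd u).deriv, norm_mul, norm_neg, Complex.norm_exp]
    gcongr
    exact (Complex.re_le_norm u).trans hu
  have h := Convex.norm_image_sub_le_of_norm_deriv_le (f := fun u : ℂ => (1 - u) * exp u)
    (s := closedBall (0 : ℂ) ‖w‖) (fun u _ => (hd u).differentiableAt) hbound
    (convex_closedBall 0 _) (mem_closedBall_self (norm_nonneg w))
    (mem_closedBall_zero_iff.mpr le_rfl)
  simp only [sub_zero, exp_zero, mul_one] at h
  calc ‖(1 - w) * exp w - 1‖ ≤ ‖w‖ * Real.exp ‖w‖ * ‖w‖ := h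
    _ = ‖w‖ ^ 2 * Real.exp ‖w‖ := by ring

/-- Scaled form: `‖(1 − z/u) e^{z/u} − 1‖ ≤ (‖z‖² e^{‖z‖/δ}) · ‖u‖⁻¹ ^ 2` for `‖u‖ ≥ δ > 0`.
[folklore] -/
private theorem norm_primaryFactor_div_sub_one_le {z u : ℂ} {δ : ℝ} (hδ : 0 < δ) (hu : δ ≤ ‖u‖) :
    ‖(1 - z / u) * exp (z / u) - 1‖ ≤ ‖z‖ ^ 2 * Real.exp (‖z‖ / δ) * ‖u‖⁻¹ ^ 2 := by
  have hu0 : 0 < ‖u‖ := hδ.trans_le hu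
  refine (norm_primaryFactor_sub_one_le (z / u)).trans ?_
  rw [norm_div]
  have h1 : ‖z‖ / ‖u‖ ≤ ‖z‖ / δ := div_le_div_of_nonneg_left (norm_nonneg z) hδ hu
  calc (‖z‖ / ‖u‖) ^ 2 * Real.exp (‖z‖ / ‖u‖) ≤ (‖z‖ / ‖u‖) ^ 2 * Real.exp (‖z‖ / δ) := by
        gcongr
    _ = ‖z‖ ^ 2 * Real.exp (‖z‖ / δ) * ‖u‖⁻¹ ^ 2 := by
        rw [div_eq_mul_inv, mul_pow]; ring

/-! ### Growth of order `σ < 2`: normalisation and the counting function -/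

/-- Normalisation of the growth hypothesis: from `‖f z‖ ≤ C exp (‖z‖^ρ)` (`ρ < 2`, any `C`) to
`‖f z‖ ≤ C' exp (‖z‖^σ)` with `σ = max ρ (1/2) ∈ [0, 2)` and `C' ≥ 1`. [folklore] -/
private theorem growth_normalise_two (hf : Differentiable ℂ f) {ρ C : ℝ} (hρ : ρ < 2)
    (hb : ∀ z : ℂ, ‖f z‖ ≤ C * Real.exp (‖z‖ ^ ρ)) :
    ∃ σ C' : ℝ, 0 ≤ σ ∧ σ < 2 ∧ 1 ≤ C' ∧ ∀ z : ℂ, ‖f z‖ ≤ C' * Real.exp (‖z‖ ^ σ) := by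
  obtain ⟨M₀, hM₀⟩ := (isCompact_closedBall (0 : ℂ) 1).exists_bound_of_continuousOn
    hf.continuous.continuousOn
  refine ⟨max ρ (1 / 2), max (max |C| 1) M₀, le_trans (by norm_num) (le_max_right _ _),
    max_lt hρ (by norm_num), le_trans (le_max_right _ _) (le_max_left _ _), fun z => ?_⟩
  by_cases hz : ‖z‖ ≤ 1
  · calc ‖f z‖ ≤ M₀ := hM₀ z (mem_closedBall_zero_iff.mpr hz)
      _ ≤ M₀ * Real.exp (‖z‖ ^ max ρ (1 / 2)) := by
          have hM : 0 ≤ M₀ := (norm_nonneg _).trans (hM₀ 0 (by simp))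
          have : 1 ≤ Real.exp (‖z‖ ^ max ρ (1 / 2)) := Real.one_le_exp (by positivity)
          nlinarith
      _ ≤ max (max |C| 1) M₀ * Real.exp (‖z‖ ^ max ρ (1 / 2)) := by
          gcongr; exact le_max_right _ _
  · rw [not_le] at hz
    calc ‖f z‖ ≤ C * Real.exp (‖z‖ ^ ρ) := hb z
      _ ≤ |C| * Real.exp (‖z‖ ^ ρ) := by gcongr; exact le_abs_self C
      _ ≤ |C| * Real.exp (‖z‖ ^ max ρ (1 / 2)) := by
          apply mul_le_mul_of_nonneg_left _ (abs_nonneg C)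
          exact Real.exp_le_exp.mpr (Real.rpow_le_rpow_of_exponent_le hz.le (le_max_left _ _))
      _ ≤ max (max |C| 1) M₀ * Real.exp (‖z‖ ^ max ρ (1 / 2)) := by
          gcongr; exact le_trans (le_max_left _ _) (le_max_left _ _)

/-- The counting bound from Jensen for order `σ ≤ 2`: `n(r) ≤ K₀ + K₁ r^σ` with
`K₀ = (log C - log |f 0|)/log 2`, `K₁ = 4 / log 2` (Conway's (3.3): `n(r) log 2 ≤ log M(2r)`).
[cite: Conway1978, Ch. XI Thm. 3.4 (proof, eq. (3.3))] -/
theorem count_le_two (hf : Differentiable ℂ f) (h0 : f 0 ≠ 0) {σ C : ℝ} (hσ : σ ≤ 2)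
    (hC : 1 ≤ C) (hb : ∀ z : ℂ, ‖f z‖ ≤ C * Real.exp (‖z‖ ^ σ)) {r : ℝ} (hr : 0 < r) :
    (count hf h0 r : ℝ) ≤ (Real.log C - Real.log ‖f 0‖) / Real.log 2 + 4 / Real.log 2 * r ^ σ := by
  have hM : (1 : ℝ) ≤ C * Real.exp ((2 * r) ^ σ) := by
    have : (1 : ℝ) ≤ Real.exp ((2 * r) ^ σ) := Real.one_le_exp (by positivity)
    nlinarith
  have h1 := count_le_of_bound hf h0 hr hM (fun z hz => by rw [← hz]; exact hb z)
  have hf0 : 0 < ‖f 0‖ := norm_pos_iff.mpr h0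
  have hlog2 : 0 < Real.log 2 := Real.log_pos (by norm_num)
  have h2 : Real.log (C * Real.exp ((2 * r) ^ σ) / ‖f 0‖) =
      Real.log C + (2 * r) ^ σ - Real.log ‖f 0‖ := by
    rw [Real.log_div (by positivity) hf0.ne', Real.log_mul (by positivity) (Real.exp_pos _).ne',
      Real.log_exp]
  rw [h2] at h1
  have h3 : (2 * r) ^ σ ≤ 4 * r ^ σ := by
    rw [Real.mul_rpow (by norm_num) hr.le]
    have : (2 : ℝ) ^ σ ≤ 4 := by
      calc (2 : ℝ) ^ σ ≤ (2 : ℝ) ^ (2 : ℝ) :=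
            Real.rpow_le_rpow_of_exponent_le (by norm_num) hσ
        _ = 4 := by norm_num
    exact mul_le_mul_of_nonneg_right this (by positivity)
  calc (count hf h0 r : ℝ) ≤ (Real.log C + (2 * r) ^ σ - Real.log ‖f 0‖) / Real.log 2 := h1
    _ ≤ (Real.log C + 4 * r ^ σ - Real.log ‖f 0‖) / Real.log 2 := by gcongr
    _ = (Real.log C - Real.log ‖f 0‖) / Real.log 2 + 4 / Real.log 2 * r ^ σ := by ring

/-! ### Convergence exponent `2`: `Σ m(u)/|u|²` is bounded -/

/-- `W₂` is monotone in `R`. [folklore] -/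
private theorem wsum₂_mono (hf : Differentiable ℂ f) (h0 : f 0 ≠ 0) {R R' : ℝ} (h : R ≤ R') :
    (∑ u ∈ zerosIn hf h0 R, (analyticOrderNatAt f u : ℝ) / ‖u‖ ^ 2) ≤ (∑ u ∈ zerosIn hf h0 R', (analyticOrderNatAt f u : ℝ) / ‖u‖ ^ 2) :=
  Finset.sum_le_sum_of_subset_of_nonneg (zerosIn_mono hf h0 h) fun _ _ _ => by positivity

/-- Dyadic step: `W₂(2R) ≤ W₂(R) + n(2R)/R²`. [folklore] -/
private theorem wsum₂_two_mul_le (hf : Differentiable ℂ f) (h0 : f 0 ≠ 0) {R : ℝ} (hR : 0 < R) :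
    (∑ u ∈ zerosIn hf h0 (2 * R), (analyticOrderNatAt f u : ℝ) / ‖u‖ ^ 2) ≤
      (∑ u ∈ zerosIn hf h0 R, (analyticOrderNatAt f u : ℝ) / ‖u‖ ^ 2) + count hf h0 (2 * R) / R ^ 2 := by
  rw [← Finset.sum_filter_add_sum_filter_not (zerosIn hf h0 (2 * R)) (fun u => ‖u‖ ≤ R)]
  have h1 : (zerosIn hf h0 (2 * R)).filter (fun u => ‖u‖ ≤ R) = zerosIn hf h0 R := by
    ext u
    simp only [Finset.mem_filter, mem_zerosIn]
    constructor
    · rintro ⟨⟨_, h⟩, h'⟩; exact ⟨h', h⟩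
    · rintro ⟨h, h'⟩; exact ⟨⟨by linarith, h'⟩, h⟩
  rw [h1]
  gcongr
  rw [count, Nat.cast_sum, Finset.sum_div]
  calc ∑ u ∈ (zerosIn hf h0 (2 * R)).filter (fun u => ¬‖u‖ ≤ R),
        (analyticOrderNatAt f u : ℝ) / ‖u‖ ^ 2
      ≤ ∑ u ∈ (zerosIn hf h0 (2 * R)).filter (fun u => ¬‖u‖ ≤ R),
          (analyticOrderNatAt f u : ℝ) / R ^ 2 := by
        refine Finset.sum_le_sum fun u hu => ?_
        rw [Finset.mem_filter, not_le] at hu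
        exact div_le_div_of_nonneg_left (by positivity) (by positivity)
          (pow_le_pow_left₀ hR.le hu.2.le 2)
    _ ≤ ∑ u ∈ zerosIn hf h0 (2 * R), (analyticOrderNatAt f u : ℝ) / R ^ 2 :=
        Finset.sum_le_sum_of_subset_of_nonneg (Finset.filter_subset _ _)
          fun _ _ _ => by positivity

/-- Dyadic bound for `W₂(2^K)`. [folklore] -/
private theorem wsum₂_two_pow_le (hf : Differentiable ℂ f) (h0 : f 0 ≠ 0) (K : ℕ) :
    (∑ u ∈ zerosIn hf h0 (2 ^ K), (analyticOrderNatAt f u : ℝ) / ‖u‖ ^ 2) ≤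
      (∑ u ∈ zerosIn hf h0 1, (analyticOrderNatAt f u : ℝ) / ‖u‖ ^ 2) +
      ∑ k ∈ Finset.range K, (count hf h0 (2 ^ (k + 1)) : ℝ) / 4 ^ k := by
  induction K with
  | zero => simp
  | succ K ih =>
    rw [Finset.sum_range_succ, pow_succ, mul_comm]
    have := wsum₂_two_mul_le hf h0 (R := 2 ^ K) (by positivity)
    rw [show (2 : ℝ) * 2 ^ K = 2 ^ (K + 1) by ring,
      show ((2 : ℝ) ^ K) ^ 2 = 4 ^ K by rw [← pow_mul, mul_comm, pow_mul]; norm_num] at this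
    rw [show (2 : ℝ) * 2 ^ K = 2 ^ (K + 1) by ring]
    linarith

/-- With growth of order `σ < 2`, `W₂(R) = Σ_{|u| ≤ R} m(u)/|u|²` is bounded (dyadic
decomposition + Jensen): the "first step in the proof" of Conway XI 3.4,
`Σ |aₙ|^{-(p+1)} < ∞` for `p = 1`. [cite: Conway1978, Ch. XI Thm. 3.4 (proof, first step)] -/
theorem wsum₂_le (hf : Differentiable ℂ f) (h0 : f 0 ≠ 0) {σ C : ℝ} (hσ : σ < 2) (hC : 1 ≤ C)
    (hb : ∀ z : ℂ, ‖f z‖ ≤ C * Real.exp (‖z‖ ^ σ)) :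
    ∃ c : ℝ, ∀ R : ℝ, (∑ u ∈ zerosIn hf h0 R, (analyticOrderNatAt f u : ℝ) / ‖u‖ ^ 2) ≤ c := by
  set K₀ := (Real.log C - Real.log ‖f 0‖) / Real.log 2 with hK₀
  set K₁ := 4 / Real.log 2 with hK₁
  have hK₁ : 0 ≤ K₁ := by rw [hK₁]; have := Real.log_pos (by norm_num : (1 : ℝ) < 2); positivity
  set q : ℝ := (2 : ℝ) ^ (σ - 2) with hq
  have hq0 : 0 < q := Real.rpow_pos_of_pos (by norm_num) _
  have hq1 : q < 1 := Real.rpow_lt_one_of_one_lt_of_neg (by norm_num) (by linarith)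
  -- termwise bound
  have hterm : ∀ k : ℕ, (count hf h0 (2 ^ (k + 1)) : ℝ) / 4 ^ k ≤
      |K₀| * (1 / 4) ^ k + K₁ * (2 : ℝ) ^ σ * q ^ k := by
    intro k
    have hc := count_le_two hf h0 hσ.le hC hb (r := 2 ^ (k + 1)) (by positivity)
    have h1 : ((2 : ℝ) ^ (k + 1)) ^ σ = (2 : ℝ) ^ σ * q ^ k * 4 ^ k := by
      rw [show (4 : ℝ) ^ k = (2 : ℝ) ^ (2 * k) by rw [pow_mul]; norm_num]
      rw [hq, ← Real.rpow_natCast 2 (k + 1), ← Real.rpow_mul (by norm_num),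
        ← Real.rpow_natCast q k, hq, ← Real.rpow_mul (by norm_num), ← Real.rpow_natCast 2 (2 * k),
        ← Real.rpow_add (by norm_num), ← Real.rpow_add (by norm_num)]
      congr 1; push_cast; ring
    rw [h1] at hc
    rw [div_le_iff₀ (by positivity)]
    calc (count hf h0 (2 ^ (k + 1)) : ℝ) ≤ K₀ + K₁ * ((2 : ℝ) ^ σ * q ^ k * 4 ^ k) := hc
      _ ≤ |K₀| * 1 + K₁ * ((2 : ℝ) ^ σ * q ^ k * 4 ^ k) := by
          have := le_abs_self K₀; linarith
      _ ≤ |K₀| * ((1 / 4) ^ k * 4 ^ k) + K₁ * ((2 : ℝ) ^ σ * q ^ k * 4 ^ k) := by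
          rw [← mul_pow]; norm_num
      _ = (|K₀| * (1 / 4) ^ k + K₁ * (2 : ℝ) ^ σ * q ^ k) * 4 ^ k := by ring
  refine ⟨(∑ u ∈ zerosIn hf h0 1, (analyticOrderNatAt f u : ℝ) / ‖u‖ ^ 2) +
    (|K₀| * 2 + K₁ * (2 : ℝ) ^ σ / (1 - q)), fun R => ?_⟩
  obtain ⟨K, hK⟩ := pow_unbounded_of_one_lt R (by norm_num : (1 : ℝ) < 2)
  refine (wsum₂_mono hf h0 hK.le).trans ((wsum₂_two_pow_le hf h0 K).trans ?_)
  gcongr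
  calc ∑ k ∈ Finset.range K, (count hf h0 (2 ^ (k + 1)) : ℝ) / 4 ^ k
      ≤ ∑ k ∈ Finset.range K, (|K₀| * (1 / 4) ^ k + K₁ * (2 : ℝ) ^ σ * q ^ k) :=
        Finset.sum_le_sum fun k _ => hterm k
    _ = |K₀| * ∑ k ∈ Finset.range K, (1 / 4 : ℝ) ^ k +
          K₁ * (2 : ℝ) ^ σ * ∑ k ∈ Finset.range K, q ^ k := by
        rw [Finset.sum_add_distrib, Finset.mul_sum, Finset.mul_sum]
    _ ≤ |K₀| * 2 + K₁ * (2 : ℝ) ^ σ / (1 - q) := by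
        have h1 : ∑ k ∈ Finset.range K, (1 / 4 : ℝ) ^ k ≤ 2 := by
          have := geom_sum_Ico_le_of_lt_one (x := (1 / 4 : ℝ)) (by norm_num) (by norm_num)
            (m := 0) (n := K)
          rw [← Finset.range_eq_Ico] at this
          refine this.trans ?_; norm_num
        have h2 : ∑ k ∈ Finset.range K, q ^ k ≤ 1 / (1 - q) := by
          have := geom_sum_Ico_le_of_lt_one hq0.le hq1 (m := 0) (n := K)
          rw [← Finset.range_eq_Ico, pow_zero] at this
          exact this
        have h3 : 0 ≤ K₁ * (2 : ℝ) ^ σ := by positivity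
        calc |K₀| * ∑ k ∈ Finset.range K, (1 / 4 : ℝ) ^ k +
              K₁ * (2 : ℝ) ^ σ * ∑ k ∈ Finset.range K, q ^ k
            ≤ |K₀| * 2 + K₁ * (2 : ℝ) ^ σ * (1 / (1 - q)) := by gcongr
          _ = |K₀| * 2 + K₁ * (2 : ℝ) ^ σ / (1 - q) := by ring

/-- Summability of `Σ 1/‖u‖²` over the zeros with multiplicity (index type `ZIdx f`) for growth of
order `σ < 2`. [cite: Conway1978, Ch. XI Thm. 2.6(b) / proof of Thm. 3.4] -/
theorem summable_norm_inv_sq (hf : Differentiable ℂ f) (h0 : f 0 ≠ 0) {σ C : ℝ} (hσ : σ < 2)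
    (hC : 1 ≤ C) (hb : ∀ z : ℂ, ‖f z‖ ≤ C * Real.exp (‖z‖ ^ σ)) :
    Summable fun i : ZIdx f => ‖i.pt‖⁻¹ ^ 2 := by
  obtain ⟨c, hc⟩ := wsum₂_le hf h0 hσ hC hb
  refine summable_of_sum_le (fun i => by positivity) (c := c) fun s => ?_
  calc ∑ i ∈ s, ‖i.pt‖⁻¹ ^ 2 ≤ ∑ j ∈ idxIn hf h0 (∑ i ∈ s, ‖i.pt‖), ‖j.pt‖⁻¹ ^ 2 :=
        Finset.sum_le_sum_of_subset_of_nonneg (subset_idxIn hf h0 s) fun _ _ _ => by positivity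
    _ = (∑ u ∈ zerosIn hf h0 (∑ i ∈ s, ‖i.pt‖), (analyticOrderNatAt f u : ℝ) / ‖u‖ ^ 2) := by
        rw [sum_idxIn hf h0 _ (fun u => ‖u‖⁻¹ ^ 2)]
        refine Finset.sum_congr rfl fun u _ => ?_
        rw [div_eq_mul_inv, inv_pow]
    _ ≤ c := hc _

/-! ### The zero data of a disc: divisor support versus `zerosIn` -/

/-- The support of the divisor of `f` on `|u| ≤ R₂` is the finite zero set `zerosIn f R₂`.
[folklore] -/
private theorem support_divisor_toFinset_eq (hf : Differentiable ℂ f) (h0 : f 0 ≠ 0) (R₂ : ℝ) :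
    ((divisor f (closedBall (0 : ℂ) R₂)).finiteSupport (isCompact_closedBall 0 R₂)).toFinset =
      zerosIn hf h0 R₂ := by
  ext u
  rw [Set.Finite.mem_toFinset, Function.mem_support, mem_zerosIn]
  constructor
  · intro hu
    by_cases hU : u ∈ closedBall (0 : ℂ) R₂
    · rw [divisor_apply_eq hf h0 _ hU] at hu
      exact ⟨mem_closedBall_zero_iff.mp hU,
        (analyticOrderNatAt_ne_zero_iff hf h0 u).mp (by exact_mod_cast hu)⟩
    · exact absurd (divisor_apply_of_not_mem _ hU) hu
  · rintro ⟨hu, hfu⟩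
    rw [divisor_apply_eq hf h0 _ (mem_closedBall_zero_iff.mpr hu)]
    exact_mod_cast (analyticOrderNatAt_ne_zero_iff hf h0 u).mpr hfu

/-- On the disc the divisor is the multiplicity. [folklore] -/
private theorem toNat_divisor_eq (hf : Differentiable ℂ f) (h0 : f 0 ≠ 0) {R₂ : ℝ} {u : ℂ}
    (hu : u ∈ zerosIn hf h0 R₂) :
    (divisor f (closedBall (0 : ℂ) R₂) u).toNat = analyticOrderNatAt f u := by
  rw [divisor_apply_eq hf h0 _ (mem_closedBall_zero_iff.mpr ((mem_zerosIn hf h0).mp hu).1),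
    Int.toNat_natCast]

/-- Products over the divisor support with the divisor's multiplicities are products over
`zerosIn` with the analytic orders. [folklore] -/
private theorem prod_support_divisor_eq (hf : Differentiable ℂ f) (h0 : f 0 ≠ 0) (R₂ : ℝ) (g : ℂ → ℂ) :
    ∏ u ∈ ((divisor f (closedBall (0 : ℂ) R₂)).finiteSupport (isCompact_closedBall 0 R₂)).toFinset,
        g u ^ (divisor f (closedBall (0 : ℂ) R₂) u).toNat =
      ∏ u ∈ zerosIn hf h0 R₂, g u ^ analyticOrderNatAt f u := by
  rw [support_divisor_toFinset_eq hf h0 R₂]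
  exact Finset.prod_congr rfl fun u hu => by rw [toNat_divisor_eq hf h0 hu]

/-- Sums over the divisor support weighted by the divisor are weighted sums over `zerosIn`.
[folklore] -/
private theorem sum_support_divisor_eq (hf : Differentiable ℂ f) (h0 : f 0 ≠ 0) (R₂ : ℝ) (g : ℂ → ℂ) :
    ∑ u ∈ ((divisor f (closedBall (0 : ℂ) R₂)).finiteSupport (isCompact_closedBall 0 R₂)).toFinset,
        ((divisor f (closedBall (0 : ℂ) R₂) u).toNat : ℂ) * g u =
      ∑ u ∈ zerosIn hf h0 R₂, (analyticOrderNatAt f u : ℂ) * g u := by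
  rw [support_divisor_toFinset_eq hf h0 R₂]
  exact Finset.sum_congr rfl fun u hu => by rw [toNat_divisor_eq hf h0 hu]

/-! ### The far factor is an exponential up to a small error, on a disc of fixed radius -/

/-- **`G = G(0) e^{βz} e^{φ(z)}` on `|z| < r`.** Let `G` be holomorphic on `|z| ≤ R`, zero-free on
`|z| ≤ R/2`, with `|G'/G| ≤ ε` on `|z| ≤ R/8`, and `0 < r ≤ R/16`. Put `β = G'/G(0)`. Then there is
`φ` holomorphic on `|z| < r` with `φ(0) = 0`, `G(z) = G(0) e^{βz} e^{φ(z)}` and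
`|φ(z)| ≤ (ε/(R/16)) r |z|` for `|z| < r` (the variant of the tree's
`KimLee.exists_exp_repr_farFactor`, which is the case `r = 2`). [folklore] -/
private theorem exists_exp_repr_farFactor_ball {G : ℂ → ℂ} {R ε r : ℝ} (hR : 0 < R) (hr : 0 < r)
    (hrR : r ≤ R / 16)
    (hG : AnalyticOnNhd ℂ G (closedBall (0 : ℂ) R)) (hG0 : ∀ z ∈ closedBall (0 : ℂ) (R / 2), G z ≠ 0)
    (hb : ∀ z ∈ closedBall (0 : ℂ) (R / 8), ‖logDeriv G z‖ ≤ ε) :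
    ∃ φ : ℂ → ℂ, φ 0 = 0 ∧ DifferentiableOn ℂ φ (ball (0 : ℂ) r) ∧
      (∀ z ∈ ball (0 : ℂ) r, G z = G 0 * exp (logDeriv G 0 * z) * exp (φ z)) ∧
      ∀ z ∈ ball (0 : ℂ) r, ‖φ z‖ ≤ ε / (R / 16) * r * ‖z‖ := by
  set β : ℂ := logDeriv G 0 with hβ
  set k : ℂ → ℂ := fun w => exp (-(β * w)) * G w with hk
  have hball : ∀ w ∈ ball (0 : ℂ) r, w ∈ closedBall (0 : ℂ) (R / 16) := fun w hw => by
    rw [mem_ball, dist_zero_right] at hw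
    exact mem_closedBall_zero_iff.2 (by linarith)
  have hGw : ∀ w ∈ ball (0 : ℂ) r, G w ≠ 0 := fun w hw =>
    hG0 w (closedBall_subset_closedBall (by linarith) (hball w hw))
  have hGan : ∀ w ∈ ball (0 : ℂ) r, AnalyticAt ℂ G w := fun w hw =>
    hG w (closedBall_subset_closedBall (by linarith) (hball w hw))
  have hkd : ∀ w ∈ ball (0 : ℂ) r, HasDerivAt k (exp (-(β * w)) * (-β) * G w +
      exp (-(β * w)) * deriv G w) w := fun w hw => by
    have h1 : HasDerivAt (fun w : ℂ => exp (-(β * w))) (exp (-(β * w)) * (-β)) w := by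
      have := ((hasDerivAt_id w).const_mul β).neg.cexp
      simpa using this
    exact h1.mul (hGan w hw).differentiableAt.hasDerivAt
  have hkdiff : DifferentiableOn ℂ k (ball (0 : ℂ) r) := fun w hw =>
    (hkd w hw).differentiableAt.differentiableWithinAt
  have hk0 : ∀ w ∈ ball (0 : ℂ) r, k w ≠ 0 := fun w hw =>
    mul_ne_zero (exp_ne_zero _) (hGw w hw)
  obtain ⟨φ, hφd, hφ0, hφderiv, hφrepr⟩ := exists_log_on_ball hkdiff hk0
  have hkc : k 0 = G 0 := by simp [hk]
  have hφ' : ∀ w ∈ ball (0 : ℂ) r, deriv φ w = logDeriv G w - β := fun w hw => by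
    rw [(hφderiv w hw).deriv, (hkd w hw).deriv, hk]
    have hGw0 := hGw w hw
    have he : exp (-(β * w)) ≠ 0 := exp_ne_zero _
    rw [logDeriv_apply]
    field_simp
    ring
  refine ⟨φ, hφ0, hφd, fun z hz => ?_, fun z hz => ?_⟩
  · have h : exp (-(β * z)) * G z = G 0 * exp (φ z) := by
      have := hφrepr z hz
      rwa [hkc, hk] at this
    have he : exp (β * z) * exp (-(β * z)) = 1 := by
      rw [← Complex.exp_add, add_neg_cancel, exp_zero]
    calc G z = exp (β * z) * (exp (-(β * z)) * G z) := by rw [← mul_assoc, he, one_mul]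
      _ = G 0 * exp (logDeriv G 0 * z) * exp (φ z) := by rw [h, hβ]; ring
  · have hε : 0 ≤ ε / (R / 16) := by
      have := (norm_nonneg _).trans (hb 0 (mem_closedBall_self (by positivity)))
      positivity
    have hbound : ∀ w ∈ ball (0 : ℂ) r, ‖deriv φ w‖ ≤ ε / (R / 16) * r := fun w hw => by
      rw [hφ' w hw, hβ]
      have h1 := norm_logDeriv_sub_logDeriv_zero_le hR hG hG0 hb (hball w hw)
      rw [mem_ball, dist_zero_right] at hw
      calc ‖logDeriv G w - logDeriv G 0‖ ≤ ε / (R / 16) * ‖w‖ := h1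
        _ ≤ ε / (R / 16) * r := by gcongr
    have h := Convex.norm_image_sub_le_of_norm_deriv_le (f := φ) (s := ball (0 : ℂ) r)
      (fun w hw => (hφderiv w hw).differentiableAt) hbound (convex_ball 0 r)
      (mem_ball_self hr) hz
    simpa [hφ0] using h

/-- The logarithmic derivative of the far factor at the origin:
`G'/G(0) = f'/f(0) + Σ_{|u| ≤ R/2} m(u)/u`. [folklore] -/
private theorem logDeriv_farFactor_zero (hf : Differentiable ℂ f) (h0 : f 0 ≠ 0) {R : ℝ} (hR : 0 < R)
    {G : ℂ → ℂ} (hG : AnalyticOnNhd ℂ G (closedBall (0 : ℂ) R))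
    (hFPG : ∀ z ∈ closedBall (0 : ℂ) R, f z =
      (∏ u ∈ ((divisor f (closedBall (0 : ℂ) (R / 2))).finiteSupport
          (isCompact_closedBall 0 (R / 2))).toFinset,
        (z - u) ^ (divisor f (closedBall (0 : ℂ) (R / 2)) u).toNat) * G z) :
    logDeriv G 0 = logDeriv f 0 +
      ∑ u ∈ zerosIn hf h0 (R / 2), (analyticOrderNatAt f u : ℂ) * u⁻¹ := by
  classical
  set D := divisor f (closedBall (0 : ℂ) (R / 2)) with hD
  set S := (D.finiteSupport (isCompact_closedBall 0 (R / 2))).toFinset with hS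
  set P : ℂ → ℂ := fun w => ∏ u ∈ S, (w - u) ^ (D u).toNat with hP
  have h0R : (0 : ℂ) ∈ closedBall (0 : ℂ) R := mem_closedBall_self hR.le
  have hPG : f 0 = P 0 * G 0 := hFPG 0 h0R
  have hP0 : P 0 ≠ 0 := fun h => h0 (by rw [hPG, h, zero_mul])
  have hG0 : G 0 ≠ 0 := fun h => h0 (by rw [hPG, h, mul_zero])
  have hev : f =ᶠ[𝓝 0] fun w => P w * G w := by
    filter_upwards [isOpen_ball.mem_nhds (mem_ball_self hR)] with w hw
      using hFPG w (ball_subset_closedBall hw)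
  have hlogF : logDeriv f 0 = logDeriv (fun w => P w * G w) 0 := by
    rw [logDeriv_apply, logDeriv_apply, hev.deriv_eq, hev.eq_of_nhds]
  have hmul := logDeriv_mul (0 : ℂ) hP0 hG0 ((differentiable_prod_pow_sub S _) 0)
    (hG 0 h0R).differentiableAt
  have h0S : ∀ a ∈ S, (0 : ℂ) ≠ a := by
    intro a ha h
    subst h
    exact hP0 ((prod_pow_sub_eq_zero_iff hf).2 ha)
  have hlogP : logDeriv P 0 = -∑ u ∈ S, ((D u).toNat : ℂ) * u⁻¹ := by
    rw [logDeriv_apply, hP, deriv_prod_pow_sub_div _ h0S, ← Finset.sum_neg_distrib]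
    refine Finset.sum_congr rfl fun u _ => ?_
    rw [zero_sub, div_neg, div_eq_mul_inv]
  have hG_eq : logDeriv G 0 = logDeriv f 0 + ∑ u ∈ S, ((D u).toNat : ℂ) * u⁻¹ := by
    rw [hlogF, hmul, hlogP]; ring
  rw [hG_eq, hS, hD, sum_support_divisor_eq hf h0 (R / 2) (fun u => u⁻¹)]

/-! ### The genus-one identity at a radius `R` -/

/-- **The identity at radius `R`.** For `f` entire, `f 0 ≠ 0`, `‖f‖ ≤ B` on `|z| ≤ R`, and
`0 < r ≤ R/16`: there is `φ` with `|φ(z)| ≤ 16 ε_R r |z| / R` on `|z| < r`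
(`ε_R = (16/R)(log(B/|f(0)|) + N(R/2) log 2 + 1)`, Titchmarsh's bound) such that
`∏_{|u| ≤ R/2} E₁(z/u)^{m(u)} = f(z)/(f(0) e^{A z}) · e^{−φ(z)}`, `A = f'(0)/f(0)`, for `|z| < r`.
[cite: Conway1978, Ch. XI Thm. 3.4 (proof, genus one)] -/
theorem partialProduct_eq (hf : Differentiable ℂ f) (h0 : f 0 ≠ 0) {R B r : ℝ} (hR : 0 < R)
    (hr : 0 < r) (hrR : r ≤ R / 16) (hB : ∀ z ∈ closedBall (0 : ℂ) R, ‖f z‖ ≤ B) :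
    ∃ φ : ℂ → ℂ, (∀ z ∈ ball (0 : ℂ) r, ‖φ z‖ ≤
        16 / R * (Real.log (B / ‖f 0‖) + (count hf h0 (R / 2) : ℝ) * Real.log 2 + 1) /
          (R / 16) * r * ‖z‖) ∧
      ∀ z ∈ ball (0 : ℂ) r,
        ∏ u ∈ zerosIn hf h0 (R / 2), ((1 - z / u) * exp (z / u)) ^ analyticOrderNatAt f u =
          f z / (f 0 * exp (deriv f 0 / f 0 * z)) * exp (-φ z) := by
  classical
  obtain ⟨G, hGan, hG0, hFPG⟩ := exists_eq_prod_pow_sub_mul (f := f) (c := 0) (R₂ := R / 2)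
    (R := R) (by positivity) (by linarith) (analyticOnNhd_of_entire hf _) h0
  set D := divisor f (closedBall (0 : ℂ) (R / 2)) with hD
  set S := (D.finiteSupport (isCompact_closedBall 0 (R / 2))).toFinset with hS
  have h0R : (0 : ℂ) ∈ closedBall (0 : ℂ) R := mem_closedBall_self hR.le
  have hP0 : ∏ u ∈ S, ((0 : ℂ) - u) ^ (D u).toNat ≠ 0 := fun h =>
    h0 (by rw [hFPG 0 h0R, h, zero_mul])
  have hG00 : G 0 ≠ 0 := fun h => h0 (by rw [hFPG 0 h0R, h, mul_zero])
  -- Titchmarsh's bound for `G'/G` on `|z| ≤ R/8`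
  set ε : ℝ := 16 / R * (Real.log (B / ‖f 0‖) + (∑ u ∈ S, (D u : ℝ)) * Real.log 2 + 1) with hε
  have hεb0 : ∀ z ∈ closedBall (0 : ℂ) (R / 8), f z ≠ 0 → ‖logDeriv G z‖ ≤ ε :=
    fun z hz hFz => norm_logDeriv_farFactor_le_of_ne_zero hf h0 hR hB hGan hFPG hz hFz
  have hcont : ContinuousOn (logDeriv G) (closedBall (0 : ℂ) (R / 8)) := fun z hz => by
    rw [mem_closedBall_zero_iff] at hz
    exact (differentiableAt_logDeriv (hGan z (mem_closedBall_zero_iff.2 (by linarith)))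
      (hG0 z (mem_closedBall_zero_iff.2 (by linarith)))).continuousAt.continuousWithinAt
  have hεb : ∀ z ∈ closedBall (0 : ℂ) (R / 8), ‖logDeriv G z‖ ≤ ε :=
    norm_le_of_forall_ne_zero hf h0 hcont hεb0
  -- the count
  have hcount : (∑ u ∈ S, (D u : ℝ)) = (count hf h0 (R / 2) : ℝ) := by
    rw [hS, hD, support_divisor_toFinset_eq hf h0 (R / 2), count, Nat.cast_sum]
    refine Finset.sum_congr rfl fun u hu => ?_
    rw [divisor_apply_eq hf h0 _ (mem_closedBall_zero_iff.mpr ((mem_zerosIn hf h0).mp hu).1)]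
    push_cast
    rfl
  -- the representation of the far factor
  obtain ⟨φ, hφ0, -, hGrepr, hφb⟩ := exists_exp_repr_farFactor_ball hR hr hrR hGan hG0 hεb
  have hβ := logDeriv_farFactor_zero hf h0 hR hGan hFPG
  refine ⟨φ, fun z hz => ?_, fun z hz => ?_⟩
  · have := hφb z hz
    rw [hε, hcount] at this
    exact this
  · have hzR : z ∈ closedBall (0 : ℂ) R := by
      rw [mem_ball_zero_iff] at hz; exact mem_closedBall_zero_iff.2 (by linarith)
    have hfz : f z = (∏ u ∈ S, (z - u) ^ (D u).toNat) * G z := hFPG z hzR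
    have hf0 : f 0 = (∏ u ∈ S, ((0 : ℂ) - u) ^ (D u).toNat) * G 0 := hFPG 0 h0R
    -- rewrite everything over `zerosIn`
    have hS0 : ∀ u ∈ zerosIn hf h0 (R / 2), u ≠ 0 := fun u hu =>
      norm_pos_iff.mp (norm_pos_of_mem_zerosIn hf h0 hu)
    rw [hS, hD, prod_support_divisor_eq hf h0] at hfz hf0 hP0
    -- the product of the `E₁`-factors splits
    have hsplit : ∏ u ∈ zerosIn hf h0 (R / 2), ((1 - z / u) * exp (z / u)) ^ analyticOrderNatAt f u
        = (∏ u ∈ zerosIn hf h0 (R / 2), (1 - z / u) ^ analyticOrderNatAt f u) *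
          exp ((∑ u ∈ zerosIn hf h0 (R / 2), (analyticOrderNatAt f u : ℂ) * u⁻¹) * z) := by
      rw [Finset.sum_mul, Complex.exp_sum, ← Finset.prod_mul_distrib]
      refine Finset.prod_congr rfl fun u _ => ?_
      rw [mul_pow, mul_assoc (analyticOrderNatAt f u : ℂ), Complex.exp_nat_mul, div_eq_mul_inv,
        mul_comm z]
    -- the quotient `P(z)/P(0)`
    have hquot : ∏ u ∈ zerosIn hf h0 (R / 2), (1 - z / u) ^ analyticOrderNatAt f u =
        (∏ u ∈ zerosIn hf h0 (R / 2), (z - u) ^ analyticOrderNatAt f u) /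
          ∏ u ∈ zerosIn hf h0 (R / 2), ((0 : ℂ) - u) ^ analyticOrderNatAt f u := by
      rw [← Finset.prod_div_distrib]
      refine Finset.prod_congr rfl fun u hu => ?_
      rw [← div_pow]
      congr 1
      have hu0 := hS0 u hu
      field_simp
      ring
    rw [hsplit, hquot, hfz, hGrepr z hz, hβ, logDeriv_apply, hf0, add_mul, Complex.exp_add,
      Complex.exp_neg]
    have hE : exp (φ z) ≠ 0 := exp_ne_zero _
    have hL : exp (deriv f 0 / ((∏ u ∈ zerosIn hf h0 (R / 2), ((0 : ℂ) - u) ^ analyticOrderNatAt f u)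
      * G 0) * z) ≠ 0 := exp_ne_zero _
    have hSig : exp ((∑ u ∈ zerosIn hf h0 (R / 2), (analyticOrderNatAt f u : ℂ) * u⁻¹) * z) ≠ 0 :=
      exp_ne_zero _
    field_simp

/-! ### The size of the error -/

/-- Jensen: `n(R/2) log 2 ≤ log(max(1, C)/|f(0)|) + R^σ` for `|f(z)| ≤ C e^{|z|^σ}`
(the tree's `count_le_of_bound`; cf. `KimLee.sum_divisor_mul_log_two_le`). [folklore] -/
private theorem count_half_mul_log_two_le (hf : Differentiable ℂ f) (h0 : f 0 ≠ 0) {σ C : ℝ}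
    (hb : ∀ z : ℂ, ‖f z‖ ≤ C * Real.exp (‖z‖ ^ σ)) {R : ℝ} (hR : 0 < R) :
    (count hf h0 (R / 2) : ℝ) * Real.log 2 ≤ Real.log (max 1 C / ‖f 0‖) + R ^ σ := by
  set M : ℝ := max 1 C * Real.exp (R ^ σ) with hM
  have hM1 : 1 ≤ M := by
    have : 1 ≤ Real.exp (R ^ σ) := Real.one_le_exp (by positivity)
    calc (1 : ℝ) = 1 * 1 := by ring
      _ ≤ max 1 C * Real.exp (R ^ σ) := mul_le_mul (le_max_left _ _) this zero_le_one (by positivity)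
  have hb' : ∀ z : ℂ, ‖z‖ = 2 * (R / 2) → ‖f z‖ ≤ M := fun z hz => by
    have hzR : ‖z‖ = R := by rw [hz]; ring
    calc ‖f z‖ ≤ C * Real.exp (‖z‖ ^ σ) := hb z
      _ ≤ max 1 C * Real.exp (‖z‖ ^ σ) := by gcongr; exact le_max_right _ _
      _ = M := by rw [hM, hzR]
  have hc := count_le_of_bound hf h0 (by positivity : 0 < R / 2) hM1 hb'
  have hlog2 : 0 < Real.log 2 := Real.log_pos one_lt_two
  have hF0 : 0 < ‖f 0‖ := norm_pos_iff.2 h0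
  have hmaxC : 0 < max 1 C := lt_of_lt_of_le one_pos (le_max_left _ _)
  calc (count hf h0 (R / 2) : ℝ) * Real.log 2 ≤ Real.log (M / ‖f 0‖) / Real.log 2 * Real.log 2 := by
        gcongr
    _ = Real.log (M / ‖f 0‖) := div_mul_cancel₀ _ hlog2.ne'
    _ = Real.log (max 1 C / ‖f 0‖) + R ^ σ := by
        rw [hM, mul_div_right_comm, Real.log_mul (by positivity) (Real.exp_pos _).ne', Real.log_exp]

/-- **The size of Titchmarsh's bound** for `|f(z)| ≤ C e^{|z|^σ}` and `B = C e^{R^σ}`: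
`(16/R)(log(B/|f(0)|) + n(R/2) log 2 + 1) ≤ (16/R)(K + 2 R^σ)` with
`K = log(C/|f(0)|) + log(max(1,C)/|f(0)|) + 1` (cf. `KimLee.titchmarshBound_le`). [folklore] -/
private theorem titchmarshBound_le (hf : Differentiable ℂ f) (h0 : f 0 ≠ 0) {σ C : ℝ}
    (hb : ∀ z : ℂ, ‖f z‖ ≤ C * Real.exp (‖z‖ ^ σ)) {R : ℝ} (hR : 0 < R) :
    16 / R * (Real.log (C * Real.exp (R ^ σ) / ‖f 0‖) + (count hf h0 (R / 2) : ℝ) * Real.log 2 + 1)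
      ≤ 16 / R * ((Real.log (C / ‖f 0‖) + Real.log (max 1 C / ‖f 0‖) + 1) + 2 * R ^ σ) := by
  have hF0 : 0 < ‖f 0‖ := norm_pos_iff.2 h0
  have hC : 0 < C := by
    by_contra hC
    push Not at hC
    have h := hb 0
    have : C * Real.exp (‖(0 : ℂ)‖ ^ σ) ≤ 0 :=
      mul_nonpos_of_nonpos_of_nonneg hC (Real.exp_pos _).le
    linarith
  have h1 : Real.log (C * Real.exp (R ^ σ) / ‖f 0‖) = Real.log (C / ‖f 0‖) + R ^ σ := by
    rw [mul_div_right_comm, Real.log_mul (by positivity) (Real.exp_pos _).ne', Real.log_exp]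
  have h2 := count_half_mul_log_two_le hf h0 hb hR
  rw [h1]
  apply mul_le_mul_of_nonneg_left _ (by positivity)
  linarith

/-! ### The main theorem (normalised growth hypothesis) -/

/-- **Hadamard, genus one** (core statement, zeros indexed by `ZIdx f`): for `f` entire with
`‖f z‖ ≤ C exp (‖z‖^σ)`, `0 ≤ σ < 2`, `C ≥ 1`, `f 0 ≠ 0`, the inverse squares of the moduli of the
zeros are summable and `f z / (f 0 · e^{(f'(0)/f(0)) z}) = ∏ (1 - z/u) e^{z/u}` over the zeros with
multiplicity (unconditional convergence). [cite: Conway1978, Ch. XI Thm. 3.4] -/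
theorem hadamard_core (hf : Differentiable ℂ f) (h0 : f 0 ≠ 0) {σ C : ℝ} (hσ0 : 0 ≤ σ)
    (hσ : σ < 2) (hC : 1 ≤ C) (hb : ∀ z : ℂ, ‖f z‖ ≤ C * Real.exp (‖z‖ ^ σ)) :
    (Summable fun i : ZIdx f => ‖i.pt‖⁻¹ ^ 2) ∧
      ∀ z : ℂ, HasProd (fun i : ZIdx f => (1 - z / i.pt) * exp (z / i.pt))
        (f z / (f 0 * exp (deriv f 0 / f 0 * z))) := by
  have hsum := summable_norm_inv_sq hf h0 hσ hC hb
  refine ⟨hsum, fun z => ?_⟩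
  -- a zero-free disc about the origin
  obtain ⟨δ₀, hδ₀, hδ⟩ : ∃ δ₀ > 0, ∀ w : ℂ, ‖w‖ < δ₀ → f w ≠ 0 := by
    have hev := (hf.continuous.continuousAt (x := (0 : ℂ))).eventually_ne h0
    obtain ⟨δ₀, hδ₀, h⟩ := Metric.eventually_nhds_iff.mp hev
    exact ⟨δ₀, hδ₀, fun w hw => h (by simpa [dist_zero_right] using hw)⟩
  have hzero : ∀ i : ZIdx f, δ₀ ≤ ‖i.pt‖ := fun i => not_lt.mp fun h => hδ i.pt h i.f_pt
  -- the product converges absolutely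
  have hmult : Multipliable fun i : ZIdx f => (1 - z / i.pt) * exp (z / i.pt) := by
    have h1 : Summable fun i : ZIdx f => ‖(1 - z / i.pt) * exp (z / i.pt) - 1‖ :=
      Summable.of_nonneg_of_le (fun i => norm_nonneg _)
        (fun i => norm_primaryFactor_div_sub_one_le hδ₀ (hzero i)) (hsum.mul_left _)
    have := multipliable_one_add_of_summable h1
    simpa using this
  -- the limit value and the fixed disc
  set L : ℂ := f z / (f 0 * exp (deriv f 0 / f 0 * z)) with hL
  set r : ℝ := ‖z‖ + 1 with hr
  have hr0 : 0 < r := by rw [hr]; positivity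
  have hzr : z ∈ ball (0 : ℂ) r := by rw [mem_ball_zero_iff, hr]; linarith
  set K : ℝ := Real.log (C / ‖f 0‖) + Real.log (max 1 C / ‖f 0‖) + 1 with hK
  -- the identity at every radius `R ≥ 16 r`, with its error
  have key : ∀ R : ℝ, ∃ φ : ℂ, 16 * r ≤ R →
      (‖φ‖ ≤ 256 * r * ‖z‖ * ((K + 2 * R ^ σ) / R ^ 2) ∧
        ∏ i ∈ idxIn hf h0 (R / 2), (1 - z / i.pt) * exp (z / i.pt) = L * exp (-φ)) := by
    intro R
    by_cases hR : 16 * r ≤ R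
    · have hR0 : 0 < R := by linarith
      have hBR : ∀ w ∈ closedBall (0 : ℂ) R, ‖f w‖ ≤ C * Real.exp (R ^ σ) := fun w hw => by
        rw [mem_closedBall_zero_iff] at hw
        calc ‖f w‖ ≤ C * Real.exp (‖w‖ ^ σ) := hb w
          _ ≤ C * Real.exp (R ^ σ) := by gcongr
      obtain ⟨φ, hφb, hφeq⟩ := partialProduct_eq hf h0 hR0 hr0 (by linarith) hBR
      refine ⟨φ z, fun _ => ⟨?_, ?_⟩⟩
      · have h1 := hφb z hzr
        have h2 := titchmarshBound_le hf h0 hb hR0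
        have h3 : 0 ≤ r * ‖z‖ := by positivity
        calc ‖φ z‖ ≤ 16 / R * (Real.log (C * Real.exp (R ^ σ) / ‖f 0‖) +
              (count hf h0 (R / 2) : ℝ) * Real.log 2 + 1) / (R / 16) * r * ‖z‖ := h1
          _ ≤ 16 / R * (K + 2 * R ^ σ) / (R / 16) * r * ‖z‖ := by
              rw [hK]; gcongr
          _ = 256 * r * ‖z‖ * ((K + 2 * R ^ σ) / R ^ 2) := by
              field_simp; ring
      · rw [prod_idxIn hf h0 (R / 2) (fun u => (1 - z / u) * exp (z / u))]
        exact hφeq z hzr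
    · exact ⟨0, fun h => absurd h hR⟩
  choose φ hφ using key
  have hev : ∀ᶠ R in atTop, 16 * r ≤ R := eventually_ge_atTop _
  -- `φ R → 0`
  have hφlim : Tendsto φ atTop (𝓝 0) := by
    rw [tendsto_zero_iff_norm_tendsto_zero]
    have hlim : Tendsto (fun R : ℝ => 256 * r * ‖z‖ * ((K + 2 * R ^ σ) / R ^ 2)) atTop (𝓝 0) := by
      have := (tendsto_err hσ K).const_mul (256 * r * ‖z‖)
      rwa [mul_zero] at this
    refine squeeze_zero' (Eventually.of_forall fun R => norm_nonneg _) ?_ hlim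
    filter_upwards [hev] with R hR using (hφ R hR).1
  -- the partial products over discs tend to `L`
  have T1 : Tendsto (fun R : ℝ => ∏ i ∈ idxIn hf h0 (R / 2), (1 - z / i.pt) * exp (z / i.pt))
      atTop (𝓝 L) := by
    have hexp : Tendsto (fun R => exp (-φ R)) atTop (𝓝 1) := by
      have h1 : Tendsto (fun R => -φ R) atTop (𝓝 0) := by simpa using hφlim.neg
      have := (Complex.continuous_exp.tendsto 0).comp h1
      simpa [Function.comp_def] using this
    have hprod : Tendsto (fun R => L * exp (-φ R)) atTop (𝓝 L) := by
      have := hexp.const_mul L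
      simpa using this
    refine hprod.congr' ?_
    filter_upwards [hev] with R hR
    exact ((hφ R hR).2).symm
  -- and, by absolute convergence, to the unconditional product
  have hS : Tendsto (fun R : ℝ => idxIn hf h0 (R / 2)) atTop atTop := by
    refine tendsto_atTop_atTop.mpr fun s => ⟨2 * ∑ i ∈ s, ‖i.pt‖, fun R hR => ?_⟩
    exact (subset_idxIn hf h0 s).trans (idxIn_mono hf h0 (by linarith))
  have T2 : Tendsto (fun R : ℝ => ∏ i ∈ idxIn hf h0 (R / 2), (1 - z / i.pt) * exp (z / i.pt))
      atTop (𝓝 (∏' i : ZIdx f, (1 - z / i.pt) * exp (z / i.pt))) := hmult.hasProd.comp hS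
  have := tendsto_nhds_unique T2 T1
  rw [← this]
  exact hmult.hasProd

end HadamardGenusOne

open HadamardGenusZero HadamardGenusOne in
/-- **Hadamard's factorisation theorem in genus one, strong form** (Conway 1978, Ch. XI,
Thm. 3.4 with (2.3)/Def. 2.5, for order `λ < 2`). If `f` is entire, `‖f z‖ ≤ C exp (‖z‖^ρ)` for
some `ρ < 2`, and `f 0 ≠ 0`, then there is a sequence `b : ℕ → ℂ` with `Σ ‖bₙ‖² < ∞` and
`f z / (f 0 · exp ((f'(0)/f(0)) z)) = ∏ₙ (1 - bₙ z) e^{bₙ z}` (unconditionally) for every `z`; the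
non-zero `bₙ` are inverses of zeros of `f`, and for every `a ≠ 0` exactly `analyticOrderNatAt f a`
indices `n` have `bₙ = a⁻¹` (so the `bₙ` are the inverses of the zeros repeated with multiplicity,
padded with zeros). In the source's notation: `f(z) = e^{g(z)} ∏ E₁(z/aₙ)` with the polynomial
`g(z) = log f(0) + (f'(0)/f(0)) z` of degree `≤ 1`. [cite: Conway1978, Ch. XI Thm. 3.4] -/
theorem hadamard_genus_one_zeros (f : ℂ → ℂ) (ρ C : ℝ) (hf : Differentiable ℂ f) (hρ : ρ < 2)
    (hb : ∀ z : ℂ, ‖f z‖ ≤ C * Real.exp (‖z‖ ^ ρ)) (h0 : f 0 ≠ 0) :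
    ∃ b : ℕ → ℂ, Summable (fun n => ‖b n‖ ^ 2) ∧
      (∀ n, b n ≠ 0 → f (b n)⁻¹ = 0) ∧
      (∀ a : ℂ, a ≠ 0 → {n : ℕ | b n = a⁻¹}.ncard = analyticOrderNatAt f a) ∧
      ∀ z : ℂ, HasProd (fun n => (1 - b n * z) * exp (b n * z))
        (f z / (f 0 * exp (deriv f 0 / f 0 * z))) := by
  obtain ⟨σ, C', hσ0, hσ, hC', hb'⟩ := growth_normalise_two hf hρ hb
  obtain ⟨hsum, hprod⟩ := hadamard_core hf h0 hσ0 hσ hC' hb'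
  haveI := countable_ZIdx hf h0
  obtain ⟨e, he⟩ := Countable.exists_injective_nat (ZIdx f)
  set b : ℕ → ℂ := Function.extend e (fun i => (i.pt)⁻¹) 0 with hb_def
  have hbe : ∀ i, b (e i) = (i.pt)⁻¹ := fun i => he.extend_apply _ _ i
  have hbn : ∀ n, n ∉ range e → b n = 0 := by
    intro n hn
    rw [hb_def, Function.extend_apply' _ _ _ (by simpa using hn)]
    rfl
  refine ⟨b, ?_, ?_, ?_, ?_⟩
  · refine (he.summable_iff (f := fun n => ‖b n‖ ^ 2) fun n hn => by simp [hbn n hn]).mp ?_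
    refine hsum.congr fun i => ?_
    simp [Function.comp_apply, hbe, norm_inv]
  · intro n hn
    by_cases h : n ∈ range e
    · obtain ⟨i, rfl⟩ := h
      rw [hbe, inv_inv]; exact i.f_pt
    · exact absurd (hbn n h) hn
  · intro a ha
    have hset : {n : ℕ | b n = a⁻¹} = e '' {i : ZIdx f | i.pt = a} := by
      ext n
      simp only [mem_setOf_eq, mem_image]
      constructor
      · intro hn
        have hn0 : b n ≠ 0 := by rw [hn]; exact inv_ne_zero ha
        by_cases h : n ∈ range e
        · obtain ⟨i, rfl⟩ := h
          refine ⟨i, ?_, rfl⟩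
          rw [hbe] at hn
          exact inv_injective hn
        · exact absurd (hbn n h) hn0
      · rintro ⟨i, hi, rfl⟩
        rw [hbe, hi]
    rw [hset, Set.ncard_image_of_injective _ he, ncard_fibre hf h0 a]
  · intro z
    have h1 : ∀ n, n ∉ range e → (1 - b n * z) * exp (b n * z) = 1 := fun n hn => by
      simp [hbn n hn]
    refine (he.hasProd_iff (f := fun n => (1 - b n * z) * exp (b n * z)) h1).mp ?_
    have : ((fun n => (1 - b n * z) * exp (b n * z)) ∘ e) =
        fun i : ZIdx f => (1 - z / i.pt) * exp (z / i.pt) := by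
      funext i
      simp only [Function.comp_apply, hbe, div_eq_mul_inv, mul_comm z]
    rw [this]
    exact hprod z

/-- **Hadamard's factorisation theorem in genus one** (Conway 1978, Ch. XI, Thm. 3.4, order
`λ < 2`): for `f` entire with `‖f z‖ ≤ C exp (‖z‖^ρ)`, `ρ < 2`, `f 0 ≠ 0`, there is a sequence
`b : ℕ → ℂ` (the inverse zeros with multiplicity, padded with zeros) with `Σ ‖bₙ‖² < ∞` and
`f z / (f 0 · exp ((deriv f 0 / f 0) z)) = ∏ₙ (1 - bₙ z) e^{bₙ z}` for every `z`; the genus-one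
companion of the tree's `hadamard_genus_zero_holds`. [cite: Conway1978, Ch. XI Thm. 3.4] -/
theorem hadamard_genus_one (f : ℂ → ℂ) (ρ C : ℝ) (hf : Differentiable ℂ f) (hρ : ρ < 2)
    (hb : ∀ z : ℂ, ‖f z‖ ≤ C * Real.exp (‖z‖ ^ ρ)) (h0 : f 0 ≠ 0) :
    ∃ b : ℕ → ℂ, Summable (fun n => ‖b n‖ ^ 2) ∧
      ∀ z : ℂ, HasProd (fun n => (1 - b n * z) * exp (b n * z))
        (f z / (f 0 * exp (deriv f 0 / f 0 * z))) := by
  obtain ⟨b, h1, -, -, h4⟩ := hadamard_genus_one_zeros f ρ C hf hρ hb h0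
  exact ⟨b, h1, h4⟩

end Literature.Analysis.Complex

end
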